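import Summits.ABC.ABC.Theses.DefiniteXi
import Summits.ABC.ABC.Theorems.DefiniteXiFreyModularityIsModular
import Summits.ABC.ABC.Theorems.DefiniteXiFreyModularityStubAbsIrrNegThree
import Summits.ABC.ABC.Theorems.DefiniteXiFreyModularityStubFreyCaseBThreeReducible
import Summits.ABC.ABC.Theorems.DefiniteXiEisensteinQuarantineFreyEigenLinePrime
import Summits.ABC.ABC.Theorems.EisensteinQuarantine.Negative.EisensteinQuarantineFalseOfProthDepthFamily
import Summits.ABC.ABC.Theorems.DefiniteXiEisensteinQuarantineThreeAdicCalibration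
import Summits.ABC.ABC.Theorems.XiBound.Negative.XiBoundDomainSetup
import Literature.NumberTheory.Automorphic.CDTTheorem722TwoFactsProofs
import Literature.NumberTheory.Automorphic.CDTTheorem712TwoLiftsProofs
import Literature.NumberTheory.EllipticCurves.CuspFormLFunctionLevelConductorProofs
import Literature.NumberTheory.EllipticCurves.SerreFreyValuationProductProofs
import Literature.NumberTheory.EllipticCurves.ThreeDivisionFieldSwanProofs
import Literature.NumberTheory.Sieve.PrimesInAPTwoPowerModuli
import Literature.NumberTheory.EllipticCurves.TakahashiDegreeFormulaFromDictionaryHolds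
import HarnessLib

/-!
# STUB_PLAN `stub_freyModularity` (stub-critic) — crux `EisensteinQuarantine` (stmt-ABC-15023),
line `forced-pair-dlog`, skeleton `Lines/forced_pair_dlog.lean` rev 5

Companion Lean file of `STUB-PLAN-stub_freyModularity.md`.  Two parts.

**Part 1 — REV-6 CANDIDATE of the skeleton (for the line lead; nothing here is registered).**  The stub
`stub_freyModularity : DefiniteXi.FreyModularity` is route item stmt-ABC-11340 verbatim; the composition
`ProthDepthFamily_of` consumes it ONCE, through `freyEigenLinePrime_of_items = hR`, at the forced family
`E_ℓ := E_(−ℓ, ℓ−1)` (`ℓ` prime, `32·q ∣ ℓ − 1`; the integer-`λ` Legendre curve `Y² = X(X−1)(X−ℓ)`,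
semistable, conductor `rad(ℓ(ℓ−1))`).  The candidate replaces stub 2b by the two statements the use-site
actually needs:
* `stub_forcedCaseAModularity` (2b″, XL, named-fact shaped): for `E_ℓ` IN CASE A (some framed model of
  `E_ℓ[3]` absolutely irreducible over `ℚ(√−3)`) a modular parametrisation datum exists at the conductor.
  By-name closers PROVED below: `…_of_CDT_theorem_7_2_1` (Conrad–Diamond–Taylor 1999 Thm 7.2.1 ALONE:
  Langlands–Tunnell + lifting at `3` + Eichler–Shimura; no `3–5` switch, no lifting at `5`, no Elkies
  7.2.3), `…_of_freyModularity` (the item stmt-ABC-11340, hypothesis ignored), `…_of_exists_isNewformOf`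
  (BCDT Thm A).  So the reshape only ADDS closers.
* `stub_forcedCaseA` (2c, size M, closable NOW, unconditional): every `E_ℓ` is in case A — because an
  INTEGER `λ ∉ {0,1}` Legendre curve has no rational root of `Ψ₃` (Part 2), hence no `Γ_ℚ`-stable line in
  `E[3]`, contradicting the landed case-B theorem `exists_stableLine_three_freyCurve_of_caseB`
  (Diamond–Kramer + Serre Prop. 21, PROVED in tree).
Glue PROVED here: `forcedModularity_of_caseAModularity_of_caseA`, `forcedEigenLine_of_rankOne_of_forcedModularity`
(p132391 pointwise = k1's H3 without the `% 3` binder), `forcedPairDepthLaw_of_occurrence_forced` (the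
skeleton's reduction with `hR` on the family = k1's H4a without `% 3`), `prothDepthFamily_of_forcedPairDepthLaw`
(verbatim), `ProthDepthFamily_of`, `EisensteinQuarantine_refuted_of`.  Sorries of Part 1 = exactly the four
stub candidates (2a item, 2b″, 2c, 3).

**Part 2 — the helper chain for `stub_forcedCaseA` (stub-worker plan A1a → A1b → A2 → A3 → 2c).**
Signatures elaborated; A2 and the final assembly `forcedCaseA_of_helpers` PROVED; A1a, A1b, A3 are the
three lemmas to prove (sorried here), to land in ONE `--supports stmt-ABC-15023` Theorems file whose last
theorem is `stub_forcedCaseA` verbatim.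
-/

set_option linter.dupNamespace false
set_option linter.unusedVariables false

noncomputable section

namespace Summit.ABC.ABC.Cruxes.EisensteinQuarantine.ForcedPairDlog.StubPlan

open scoped BigOperators MatrixGroups ModularForm
open CongruenceSubgroup
open Literature.NumberTheory.Automorphic Literature.NumberTheory.EllipticCurves
open Literature.NumberTheory.EllipticCurves.ModularForms
open Literature.NumberTheory.Automorphic.BCDT Literature.NumberTheory.GaloisRepresentations
open Summit.ABC.ABC.Theorems.EisensteinQuarantine.Negative
open WeierstrassCurve Polynomial

/-! ## Part 1 — rev-6 candidate: the registered stubs -/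

/-- stub 1 (reference, unchanged from rev 5): the two-prime 2-power supply, PROVED in Literature. -/
theorem stub_twoPowerPrimeSupply :
    ∃ A s₁ : ℕ, ∀ s : ℕ, s₁ ≤ s →
      ∃ q ℓ : ℕ, q.Prime ∧ ℓ.Prime ∧ 2 ^ s ∣ q - 1 ∧ 2 ^ s * q ∣ ℓ - 1 ∧ ℓ ≤ 2 ^ (A * s) :=
  Literature.NumberTheory.Sieve.PrimesInAPGallagher.exists_primes_two_pow_mul_dvd_sub_one

/-- stub 2a (unchanged from rev 5) = route ITEM stmt-ABC-17203 verbatim.  Since 2026-08-17T18:0xZ the named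
fact is DISCHARGED in the tree (`takahashi2001_brandtEigenLattice_rank_one_holds`, p171053; see
`STUB-PLAN-stub_brandtEigenLatticeRankOne.md`), so in this candidate it is already a one-term proof — kept under
the registered name so the lead's 2a swap and this reshape compose in ONE re-registration. -/
theorem stub_brandtEigenLatticeRankOne : Summit.ABC.ABC.Theses.DefiniteXi.BrandtEigenLatticeRankOne := by
  exact Literature.NumberTheory.EllipticCurves.takahashi2001_brandtEigenLattice_rank_one_holds

/-- **stub 2b″ `stub_forcedCaseAModularity` (replaces rev-5 stub 2b `stub_freyModularity`; XL named-fact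
shaped).**  Modularity, in datum form, of the forced Legendre–Frey curve `E_ℓ = E_(−ℓ,ℓ−1)` (`ℓ` prime,
`32 ∣ ℓ − 1`) GIVEN case A (a framed model of `E_ℓ[3]` absolutely irreducible over `ℚ(√−3)`).  In print:
Wiles 1995 Thm 0.3 / Conrad–Diamond–Taylor 1999 Thm 7.2.1 on one semistable family.  Closers by name
(proved below): `CDT_theorem_7_2_1` alone; the item `FreyModularity` (stmt-ABC-11340); BCDT Thm A. -/
theorem stub_forcedCaseAModularity :
    ∀ ℓ : ℕ, ℓ.Prime → 32 ∣ ℓ - 1 →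
      (∃ ρ : ModPGaloisRep ℚ (ZMod 3) 2,
        (freyCurve (-(ℓ : ℤ)) ((ℓ - 1 : ℕ) : ℤ)).IsTorsionGaloisRep 3 ρ ∧
          ρ.IsAbsIrreducibleOverSqrt (-3)) →
      ∀ (N : ℕ) [NeZero N], (freyCurve (-(ℓ : ℤ)) ((ℓ - 1 : ℕ) : ℤ)).conductorNorm ℤ = N →
        Nonempty (ModularParametrizationData (freyCurve (-(ℓ : ℤ)) ((ℓ - 1 : ℕ) : ℤ)) N) := by
  sorry

/-- **stub 2c `stub_forcedCaseA` (NEW; size M; closable now, unconditional).**  Every forced Legendre–Frey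
curve `E_ℓ` (`ℓ` prime, `32 ∣ ℓ − 1`) is in case A: some framed model of `E_ℓ[3]` is absolutely
irreducible over `ℚ(√−3)`.  Plan (Part 2): `Ψ₃(E_ℓ)(x) = Ψ₃^{Leg}_λ(x + ℓ)`, `λ = ℓ`, and for an integer
`λ ∉ {0,1}` the Legendre 3-division polynomial `3X⁴ − 4(1+λ)X³ + 6λX² − λ² = 4X³(X−1)³ − (λ−3X²+2X³)²`
has no rational root; so `E_ℓ[3]` has no `Γ_ℚ`-stable line, contradicting the landed case-B theorem
`exists_stableLine_three_freyCurve_of_caseB` (`A = −ℓ ≡ −1 (mod 4)`, `2 ∣ B = ℓ − 1`). -/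
theorem stub_forcedCaseA :
    ∀ ℓ : ℕ, ℓ.Prime → 32 ∣ ℓ - 1 →
      ∃ ρ : ModPGaloisRep ℚ (ZMod 3) 2,
        (freyCurve (-(ℓ : ℤ)) ((ℓ - 1 : ℕ) : ℤ)).IsTorsionGaloisRep 3 ρ ∧
          ρ.IsAbsIrreducibleOverSqrt (-3) := by
  sorry

/-- stub 3 (unchanged from rev 5, research stub) — the forced-pair occurrence. -/
theorem stub_forcedPairOccurrence :
    ∃ c : ℕ, ∀ q ℓ : ℕ, q.Prime → ℓ.Prime → q ≠ 2 → 32 * q ∣ ℓ - 1 →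
      ∀ N : ℕ, (freyCurve (-(ℓ : ℤ)) ((ℓ - 1 : ℕ) : ℤ)).conductorNorm ℤ = N →
      ∀ (S : Brandt.XiSetup (N / ℓ) ℓ) [Fintype (Brandt.ClassSet S.O)],
        ∀ φ : Brandt.ClassSet S.O → ℤ, φ ≠ 0 →
          Brandt.eigenLattice (N / ℓ * ℓ) (Brandt.matrix S.O)
              (fun n => (freyCurve (-(ℓ : ℤ)) ((ℓ - 1 : ℕ) : ℤ)).LFunction n) = ℤ ∙ φ →
          ∃ ψ : Brandt.ClassSet S.O → ℤ,
            ∑ i, (Brandt.weight S.O i : ℤ) * ψ i * φ i = 0 ∧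
              ∀ i, ((2 ^ ((q - 1).factorization 2 - c) : ℕ) : ℤ) ∣ φ i - ψ i := by
  sorry

/-! ## Part 1 — domain facts of the forced family (proved; k1's `forced_domain` etc.) -/

/-- `(−ℓ) ⊥ (ℓ−1)`, `(−ℓ)(ℓ−1)(−1) = ℓ(ℓ−1) ≠ 0`. -/
theorem forced_domain {ℓ : ℕ} (hℓ : ℓ.Prime) :
    IsCoprime (-(ℓ : ℤ)) ((ℓ - 1 : ℕ) : ℤ) ∧
      (-(ℓ : ℤ)) * ((ℓ - 1 : ℕ) : ℤ) * (-(ℓ : ℤ) + ((ℓ - 1 : ℕ) : ℤ)) = ((ℓ * (ℓ - 1) : ℕ) : ℤ) ∧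
      (-(ℓ : ℤ)) * ((ℓ - 1 : ℕ) : ℤ) * (-(ℓ : ℤ) + ((ℓ - 1 : ℕ) : ℤ)) ≠ 0 := by
  have hℓ1 : 1 ≤ ℓ := hℓ.one_lt.le
  have hM0 : ℓ - 1 ≠ 0 := by have := hℓ.two_le; omega
  have hℓcast : (ℓ : ℤ) = ((ℓ - 1 : ℕ) : ℤ) + 1 := by
    rw [Nat.cast_sub hℓ1]; push_cast; ring
  have habc : (-(ℓ : ℤ)) * ((ℓ - 1 : ℕ) : ℤ) * (-(ℓ : ℤ) + ((ℓ - 1 : ℕ) : ℤ)) =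
      ((ℓ * (ℓ - 1) : ℕ) : ℤ) := by
    push_cast; rw [hℓcast]; ring
  have hPM0 : ℓ * (ℓ - 1) ≠ 0 := Nat.mul_ne_zero hℓ.ne_zero hM0
  refine ⟨?_, habc, ?_⟩
  · rw [IsCoprime.neg_left_iff, Int.isCoprime_iff_gcd_eq_one, Int.gcd_natCast_natCast]
    exact (Nat.coprime_self_sub_right hℓ1).mpr (Nat.coprime_one_right ℓ)
  · rw [habc]; exact_mod_cast hPM0

/-- Serre normalisation of the forced family: `−ℓ ≡ −1 (mod 4)` and `2 ∣ ℓ − 1` (indeed `32 ∣ ℓ − 1`). -/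
theorem forced_serre {ℓ : ℕ} (hℓ : ℓ.Prime) (h32 : 32 ∣ ℓ - 1) :
    (-(ℓ : ℤ)) ≡ -1 [ZMOD 4] ∧ (32 : ℤ) ∣ ((ℓ - 1 : ℕ) : ℤ) := by
  have hℓ1 : 1 ≤ ℓ := hℓ.one_lt.le
  have hℓcast : (ℓ : ℤ) = ((ℓ - 1 : ℕ) : ℤ) + 1 := by
    rw [Nat.cast_sub hℓ1]; push_cast; ring
  have hb32 : (32 : ℤ) ∣ ((ℓ - 1 : ℕ) : ℤ) := by exact_mod_cast h32
  refine ⟨?_, hb32⟩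
  have h4 : (4 : ℤ) ∣ ((ℓ - 1 : ℕ) : ℤ) := (show (4 : ℤ) ∣ 32 by norm_num).trans hb32
  have : (-(ℓ : ℤ)) = -1 - ((ℓ - 1 : ℕ) : ℤ) := by rw [hℓcast]; ring
  rw [this]
  calc -1 - ((ℓ - 1 : ℕ) : ℤ) ≡ -1 - 0 [ZMOD 4] :=
      Int.ModEq.sub_left _ ((Int.modEq_zero_iff_dvd).mpr h4)
    _ = -1 := by ring

/-- The forced family has squarefree conductor `rad(ℓ(ℓ−1))`. -/
theorem forced_squarefree_conductorNorm {ℓ : ℕ} (hℓ : ℓ.Prime) (h32 : 32 ∣ ℓ - 1) :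
    Squarefree ((freyCurve (-(ℓ : ℤ)) ((ℓ - 1 : ℕ) : ℤ)).conductorNorm ℤ) := by
  obtain ⟨hab, habc, h0⟩ := forced_domain hℓ
  obtain ⟨ha4, hb32⟩ := forced_serre hℓ h32
  haveI := isElliptic_freyCurve h0
  rw [conductorNorm_freyCurve_serre hab h0 ha4 hb32]
  exact UniqueFactorizationMonoid.squarefree_radical

/-! ## Part 1 — closers of stub 2b″ by name (proved) -/

/-- **2b″ ⇐ `CDT_theorem_7_2_1` alone** (`27 ∤ N` because `9 ∤ N`, `not_nine_dvd_conductorNorm_freyCurve`;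
datum ⟺ newform, `nonempty_modularParametrizationData_iff_isModularAt`). -/
theorem stub_forcedCaseAModularity_of_CDT_theorem_7_2_1 (h721 : CDT_theorem_7_2_1) :
    ∀ ℓ : ℕ, ℓ.Prime → 32 ∣ ℓ - 1 →
      (∃ ρ : ModPGaloisRep ℚ (ZMod 3) 2,
        (freyCurve (-(ℓ : ℤ)) ((ℓ - 1 : ℕ) : ℤ)).IsTorsionGaloisRep 3 ρ ∧
          ρ.IsAbsIrreducibleOverSqrt (-3)) →
      ∀ (N : ℕ) [NeZero N], (freyCurve (-(ℓ : ℤ)) ((ℓ - 1 : ℕ) : ℤ)).conductorNorm ℤ = N →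
        Nonempty (ModularParametrizationData (freyCurve (-(ℓ : ℤ)) ((ℓ - 1 : ℕ) : ℤ)) N) := by
  intro ℓ hℓ h32 hA N _ hN
  obtain ⟨hab, -, h0⟩ := forced_domain hℓ
  haveI := isElliptic_freyCurve h0
  haveI : NeZero ((freyCurve (-(ℓ : ℤ)) ((ℓ - 1 : ℕ) : ℤ)).conductorNorm ℤ) :=
    ⟨by rw [hN]; exact NeZero.ne N⟩
  obtain ⟨ρ, hρ, hirr⟩ := hA
  have hmod : BCDT.IsModular (freyCurve (-(ℓ : ℤ)) ((ℓ - 1 : ℕ) : ℤ)) :=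
    h721 _ ρ hρ hirr fun h27 ↦
      Summit.ABC.ABC.Theorems.not_nine_dvd_conductorNorm_freyCurve hab h0
        ((show (9 : ℕ) ∣ 27 by norm_num).trans h27)
  subst hN
  exact (Summit.ABC.ABC.Theorems.nonempty_modularParametrizationData_iff_isModularAt _ _).mpr hmod

/-- **2b″ ⇐ the item `FreyModularity` (stmt-ABC-11340)** — the case-A hypothesis is simply ignored, so the
rev-5 closer survives the reshape. -/
theorem stub_forcedCaseAModularity_of_freyModularity
    (h : Summit.ABC.ABC.Theses.DefiniteXi.FreyModularity) :
    ∀ ℓ : ℕ, ℓ.Prime → 32 ∣ ℓ - 1 →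
      (∃ ρ : ModPGaloisRep ℚ (ZMod 3) 2,
        (freyCurve (-(ℓ : ℤ)) ((ℓ - 1 : ℕ) : ℤ)).IsTorsionGaloisRep 3 ρ ∧
          ρ.IsAbsIrreducibleOverSqrt (-3)) →
      ∀ (N : ℕ) [NeZero N], (freyCurve (-(ℓ : ℤ)) ((ℓ - 1 : ℕ) : ℤ)).conductorNorm ℤ = N →
        Nonempty (ModularParametrizationData (freyCurve (-(ℓ : ℤ)) ((ℓ - 1 : ℕ) : ℤ)) N) :=
  fun ℓ hℓ _ _ N _ hN ↦ h _ _ (forced_domain hℓ).1 (forced_domain hℓ).2.2 N hN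

/-- **2b″ ⇐ BCDT Thm A** (`exists_isNewformOf`), through `freyModularity_of_exists_isNewformOf'`. -/
theorem stub_forcedCaseAModularity_of_exists_isNewformOf (h : exists_isNewformOf) :
    ∀ ℓ : ℕ, ℓ.Prime → 32 ∣ ℓ - 1 →
      (∃ ρ : ModPGaloisRep ℚ (ZMod 3) 2,
        (freyCurve (-(ℓ : ℤ)) ((ℓ - 1 : ℕ) : ℤ)).IsTorsionGaloisRep 3 ρ ∧
          ρ.IsAbsIrreducibleOverSqrt (-3)) →
      ∀ (N : ℕ) [NeZero N], (freyCurve (-(ℓ : ℤ)) ((ℓ - 1 : ℕ) : ℤ)).conductorNorm ℤ = N →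
        Nonempty (ModularParametrizationData (freyCurve (-(ℓ : ℤ)) ((ℓ - 1 : ℕ) : ℤ)) N) :=
  stub_forcedCaseAModularity_of_freyModularity
    (Summit.ABC.ABC.Theorems.freyModularity_of_exists_isNewformOf' h)

/-- **BCDT (3) ⇒ (2) for SQUAREFREE conductor, granted Eichler–Shimura only** (Carayol's level theorem is
the tree's `IsNewformOf.level_eq_conductorNorm_of_squarefree` in this scope; Faltings is
`isIsogenous_iff_frobeniusTrace_eq_holds`) — k1's H1′a, verbatim. -/
theorem isModular_of_isModularGaloisRepTate_of_eichlerShimura_of_squarefree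
    (hES : eichlerShimuraConstruction)
    (W : WeierstrassCurve ℚ) [W.IsElliptic] [NeZero (W.conductorNorm ℤ)]
    (hsq : Squarefree (W.conductorNorm ℤ)) (ℓ : ℕ) [Fact ℓ.Prime]
    (h : W.IsModularGaloisRepTate ℓ) : BCDT.IsModular W := by
  classical
  have hℓp : ℓ.Prime := Fact.out
  obtain ⟨N, hN, f, hf, hint, hcoeff⟩ := exists_rational_isNewform0_of_isModularGaloisRepTate' W ℓ h
  haveI : NeZero (N * (ℓ * W.conductorNorm ℤ)) :=
    ⟨mul_ne_zero (NeZero.ne N) (mul_ne_zero hℓp.ne_zero (NeZero.ne _))⟩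
  obtain ⟨W', hW', hW'f, -⟩ := hES hf hint
  have hiso : IsIsogenous W W' := by
    refine WeierstrassCurve.isIsogenous_of_finite_setOf_LFunction_ne
      isIsogenous_iff_frobeniusTrace_eq_holds W W' ?_
    refine (N * (ℓ * W.conductorNorm ℤ)).primeFactors.finite_toSet.subset ?_
    rintro p ⟨hp, hne⟩
    refine (Nat.mem_primeFactors_of_ne_zero (NeZero.ne _)).mpr ⟨hp, ?_⟩
    by_contra hpM
    exact hne (by exact_mod_cast (hcoeff p hp hpM).symm.trans (hW'f.2 p))
  have hWf : IsNewformOf W f := ⟨hf, fun n ↦ by rw [hW'f.2 n, hiso.LFunction_eq]⟩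
  have hNE : N = W.conductorNorm ℤ := hWf.level_eq_conductorNorm_of_squarefree hsq
  subst hNE
  exact ⟨f, hWf⟩

/-- **2b″ ⇐ three of the five atoms of the `FreyModularity` line** (`Cruxes/FreyModularity/Lines/Sketch.lean`):
Langlands–Tunnell (`stub_modThree` shape), lifting at `3` for `9 ∤ N` (`stub_liftThree` shape) and
Eichler–Shimura — no `stub_switch`, no `stub_liftFive`; Carayol PROVED (squarefree).  k1's H1′b with the
case-A hypothesis supplied instead of derived. -/
theorem stub_forcedCaseAModularity_of_atoms
    (hmod3 : ∀ (W : WeierstrassCurve ℚ) [W.IsElliptic] (ρ : ModPGaloisRep ℚ (ZMod 3) 2),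
      W.IsTorsionGaloisRep 3 ρ → FramedRep.IsAbsolutelyIrreducible ρ → ρ.IsModular)
    (hlift3 : ∀ (W : WeierstrassCurve ℚ) [W.IsElliptic] (ρ : ModPGaloisRep ℚ (ZMod 3) 2),
      W.IsTorsionGaloisRep 3 ρ → ρ.IsAbsIrreducibleOverSqrt (-3) → ¬ 9 ∣ W.conductorNorm ℤ →
      ρ.IsModular → W.IsModularGaloisRepTate 3)
    (hES : eichlerShimuraConstruction) :
    ∀ ℓ : ℕ, ℓ.Prime → 32 ∣ ℓ - 1 →
      (∃ ρ : ModPGaloisRep ℚ (ZMod 3) 2,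
        (freyCurve (-(ℓ : ℤ)) ((ℓ - 1 : ℕ) : ℤ)).IsTorsionGaloisRep 3 ρ ∧
          ρ.IsAbsIrreducibleOverSqrt (-3)) →
      ∀ (N : ℕ) [NeZero N], (freyCurve (-(ℓ : ℤ)) ((ℓ - 1 : ℕ) : ℤ)).conductorNorm ℤ = N →
        Nonempty (ModularParametrizationData (freyCurve (-(ℓ : ℤ)) ((ℓ - 1 : ℕ) : ℤ)) N) := by
  intro ℓ hℓ h32 hA N _ hN
  obtain ⟨hab, -, h0⟩ := forced_domain hℓ
  haveI := isElliptic_freyCurve h0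
  haveI : NeZero ((freyCurve (-(ℓ : ℤ)) ((ℓ - 1 : ℕ) : ℤ)).conductorNorm ℤ) :=
    ⟨by rw [hN]; exact NeZero.ne N⟩
  obtain ⟨ρ, hρ, hirr⟩ := hA
  have h9 : ¬ 9 ∣ (freyCurve (-(ℓ : ℤ)) ((ℓ - 1 : ℕ) : ℤ)).conductorNorm ℤ :=
    Summit.ABC.ABC.Theorems.not_nine_dvd_conductorNorm_freyCurve hab h0
  have hTate : (freyCurve (-(ℓ : ℤ)) ((ℓ - 1 : ℕ) : ℤ)).IsModularGaloisRepTate 3 :=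
    hlift3 _ ρ hρ hirr h9 (hmod3 _ ρ hρ hirr.isAbsolutelyIrreducible)
  have hmod : BCDT.IsModular (freyCurve (-(ℓ : ℤ)) ((ℓ - 1 : ℕ) : ℤ)) :=
    isModular_of_isModularGaloisRepTate_of_eichlerShimura_of_squarefree hES _
      (forced_squarefree_conductorNorm hℓ h32) 3 hTate
  subst hN
  exact (Summit.ABC.ABC.Theorems.nonempty_modularParametrizationData_iff_isModularAt _ _).mpr hmod

/-! ## Part 1 — the reshaped glue (proved) -/

/-- 2b″ + 2c ⟹ modularity data on the whole forced family (the `LegendreModularity` of k2). -/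
theorem forcedModularity_of_caseAModularity_of_caseA
    (hL : ∀ ℓ : ℕ, ℓ.Prime → 32 ∣ ℓ - 1 →
      (∃ ρ : ModPGaloisRep ℚ (ZMod 3) 2,
        (freyCurve (-(ℓ : ℤ)) ((ℓ - 1 : ℕ) : ℤ)).IsTorsionGaloisRep 3 ρ ∧
          ρ.IsAbsIrreducibleOverSqrt (-3)) →
      ∀ (N : ℕ) [NeZero N], (freyCurve (-(ℓ : ℤ)) ((ℓ - 1 : ℕ) : ℤ)).conductorNorm ℤ = N →
        Nonempty (ModularParametrizationData (freyCurve (-(ℓ : ℤ)) ((ℓ - 1 : ℕ) : ℤ)) N))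
    (hA : ∀ ℓ : ℕ, ℓ.Prime → 32 ∣ ℓ - 1 →
      ∃ ρ : ModPGaloisRep ℚ (ZMod 3) 2,
        (freyCurve (-(ℓ : ℤ)) ((ℓ - 1 : ℕ) : ℤ)).IsTorsionGaloisRep 3 ρ ∧
          ρ.IsAbsIrreducibleOverSqrt (-3)) :
    ∀ ℓ : ℕ, ℓ.Prime → 32 ∣ ℓ - 1 →
      ∀ (N : ℕ) [NeZero N], (freyCurve (-(ℓ : ℤ)) ((ℓ - 1 : ℕ) : ℤ)).conductorNorm ℤ = N →
        Nonempty (ModularParametrizationData (freyCurve (-(ℓ : ℤ)) ((ℓ - 1 : ℕ) : ℤ)) N) :=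
  fun ℓ hℓ h32 N _ hN ↦ hL ℓ hℓ h32 (hA ℓ hℓ h32) N hN

/-- **Rank one + modularity data on the family ⟹ the Frey eigen-line on the forced family** (p132391
pointwise; k1's H3 without the class condition). -/
theorem forcedEigenLine_of_rankOne_of_forcedModularity
    (h₁ : Summit.ABC.ABC.Theses.DefiniteXi.BrandtEigenLatticeRankOne)
    (h₂ : ∀ ℓ : ℕ, ℓ.Prime → 32 ∣ ℓ - 1 →
      ∀ (N : ℕ) [NeZero N], (freyCurve (-(ℓ : ℤ)) ((ℓ - 1 : ℕ) : ℤ)).conductorNorm ℤ = N →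
        Nonempty (ModularParametrizationData (freyCurve (-(ℓ : ℤ)) ((ℓ - 1 : ℕ) : ℤ)) N)) :
    ∀ ℓ : ℕ, ℓ.Prime → 32 ∣ ℓ - 1 →
      ∀ (N : ℕ) [NeZero N], (freyCurve (-(ℓ : ℤ)) ((ℓ - 1 : ℕ) : ℤ)).conductorNorm ℤ = N →
      Squarefree N → ℓ ∣ N →
      ∀ (S : Brandt.XiSetup (N / ℓ) ℓ) [Fintype (Brandt.ClassSet S.O)],
        ∃ φ : Brandt.ClassSet S.O → ℤ, φ ≠ 0 ∧
          Brandt.eigenLattice (N / ℓ * ℓ) (Brandt.matrix S.O)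
            (fun n => (freyCurve (-(ℓ : ℤ)) ((ℓ - 1 : ℕ) : ℤ)).LFunction n) = ℤ ∙ φ := by
  intro ℓ hℓ h32 N _ hN hsq hℓN S _
  obtain ⟨hab, -, h0⟩ := forced_domain hℓ
  haveI := isElliptic_freyCurve h0
  have hNeq : N / ℓ * ℓ = N := Nat.div_mul_cancel hℓN
  haveI : NeZero (N / ℓ * ℓ) := ⟨by rw [hNeq]; exact NeZero.ne N⟩
  have hsq' : Squarefree (N / ℓ * ℓ) := by rw [hNeq]; exact hsq
  have hN' : (freyCurve (-(ℓ : ℤ)) ((ℓ - 1 : ℕ) : ℤ)).conductorNorm ℤ = N / ℓ * ℓ :=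
    hN.trans hNeq.symm
  obtain ⟨D⟩ := h₂ ℓ hℓ h32 (N / ℓ * ℓ) hN'
  have h₁' : Literature.NumberTheory.EllipticCurves.takahashi2001_brandtEigenLattice_rank_one := h₁
  exact Summit.ABC.ABC.Theorems.exists_eq_span_singleton_of_finrank_eq_one _
    (h₁' (freyCurve (-(ℓ : ℤ)) ((ℓ - 1 : ℕ) : ℤ)) (N / ℓ) ℓ hℓ hsq' hN' D S)

/-- **Eigen-line on the family + occurrence ⟹ the forced-pair depth law** (the skeleton's
`forcedPairDepthLaw_of_occurrence` with `hR` stated on the family; k1's H4a without the class condition). -/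
theorem forcedPairDepthLaw_of_occurrence_forced
    (hR : ∀ ℓ : ℕ, ℓ.Prime → 32 ∣ ℓ - 1 →
      ∀ (N : ℕ) [NeZero N], (freyCurve (-(ℓ : ℤ)) ((ℓ - 1 : ℕ) : ℤ)).conductorNorm ℤ = N →
      Squarefree N → ℓ ∣ N →
      ∀ (S : Brandt.XiSetup (N / ℓ) ℓ) [Fintype (Brandt.ClassSet S.O)],
        ∃ φ : Brandt.ClassSet S.O → ℤ, φ ≠ 0 ∧
          Brandt.eigenLattice (N / ℓ * ℓ) (Brandt.matrix S.O)
            (fun n => (freyCurve (-(ℓ : ℤ)) ((ℓ - 1 : ℕ) : ℤ)).LFunction n) = ℤ ∙ φ)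
    (hO : ∃ c : ℕ, ∀ q ℓ : ℕ, q.Prime → ℓ.Prime → q ≠ 2 → 32 * q ∣ ℓ - 1 →
      ∀ N : ℕ, (freyCurve (-(ℓ : ℤ)) ((ℓ - 1 : ℕ) : ℤ)).conductorNorm ℤ = N →
      ∀ (S : Brandt.XiSetup (N / ℓ) ℓ) [Fintype (Brandt.ClassSet S.O)],
        ∀ φ : Brandt.ClassSet S.O → ℤ, φ ≠ 0 →
          Brandt.eigenLattice (N / ℓ * ℓ) (Brandt.matrix S.O)
              (fun n => (freyCurve (-(ℓ : ℤ)) ((ℓ - 1 : ℕ) : ℤ)).LFunction n) = ℤ ∙ φ →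
          ∃ ψ : Brandt.ClassSet S.O → ℤ,
            ∑ i, (Brandt.weight S.O i : ℤ) * ψ i * φ i = 0 ∧
              ∀ i, ((2 ^ ((q - 1).factorization 2 - c) : ℕ) : ℤ) ∣ φ i - ψ i) :
    ∃ c : ℕ, ∀ q ℓ : ℕ, q.Prime → ℓ.Prime → q ≠ 2 → 32 * q ∣ ℓ - 1 →
      ∀ N : ℕ, (freyCurve (-(ℓ : ℤ)) ((ℓ - 1 : ℕ) : ℤ)).conductorNorm ℤ = N →
        2 ^ ((q - 1).factorization 2) ≤
          2 ^ c * ordProj[2] (brandtXi (N / ℓ) ℓ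
            (fun n => (freyCurve (-(ℓ : ℤ)) ((ℓ - 1 : ℕ) : ℤ)).LFunction n)) := by
  obtain ⟨c, hc⟩ := hO
  refine ⟨c, fun q ℓ hq hℓ hq2 h32 N hN => ?_⟩
  obtain ⟨hab, habc, h0⟩ := forced_domain hℓ
  have hℓ1 : 1 ≤ ℓ := hℓ.one_lt.le
  have hM0 : ℓ - 1 ≠ 0 := by have := hℓ.two_le; omega
  have h32' : (32 : ℕ) ∣ ℓ - 1 := (Dvd.intro q rfl).trans h32
  have hℓ2 : ℓ ≠ 2 := by
    intro h
    rw [h] at h32'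
    norm_num at h32'
  have hnatAbs : ((-(ℓ : ℤ)) * ((ℓ - 1 : ℕ) : ℤ) * (-(ℓ : ℤ) + ((ℓ - 1 : ℕ) : ℤ))).natAbs =
      ℓ * (ℓ - 1) := by rw [habc, Int.natAbs_natCast]
  haveI : (freyCurve (-(ℓ : ℤ)) ((ℓ - 1 : ℕ) : ℤ)).IsElliptic := isElliptic_freyCurve h0
  have hNsq : Squarefree N := by rw [← hN]; exact forced_squarefree_conductorNorm hℓ h32'
  obtain ⟨ha4, hb32⟩ := forced_serre hℓ h32'
  have hNval : N = UniqueFactorizationMonoid.radical (ℓ * (ℓ - 1)) := by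
    rw [← hN, conductorNorm_freyCurve_serre hab h0 ha4 hb32, hnatAbs]
  have hNpos : 0 < N := by rw [hNval]; exact Nat.radical_pos _
  haveI : NeZero N := ⟨hNpos.ne'⟩
  have hℓN : ℓ ∣ N := by
    rw [hNval]
    refine Nat.dvd_of_mem_primeFactors ?_
    rw [Nat.primeFactors_radical, Nat.primeFactors_mul hℓ.ne_zero hM0, hℓ.primeFactors]
    simp
  have hodd : Odd ℓ := hℓ.odd_of_ne_two hℓ2
  have hcard : Odd ℓ.primeFactors.card := by rw [hℓ.primeFactors]; simp
  -- a Brandt setup of type `(N/ℓ, ℓ)` exists and computes `ξ`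
  have hne := Summit.ABC.ABC.Theorems.XiBound.Negative.nonempty_xiSetup_freyCurve
    hab h0 hodd hℓ.squarefree hcard (by rw [hN]; exact hℓN)
  rw [hN] at hne
  obtain ⟨S⟩ := hne
  letI : Fintype (Brandt.ClassSet S.O) := Fintype.ofFinite _
  rw [S.brandtXi_eq_xi]
  -- the eigen-line ON THE FAMILY; stub 3: the occurrence witness; landed dictionary: the depth
  obtain ⟨φ, hφ, hL⟩ := hR ℓ hℓ h32' N hN hNsq hℓN S
  obtain ⟨ψ, hψ, hcong⟩ := hc q ℓ hq hℓ hq2 h32 N hN S φ hφ hL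
  have hle := Summit.ABC.ABC.Theorems.pow_le_ordProj_xi_of_occurrence Nat.prime_two S _ hφ hL
    ((q - 1).factorization 2 - c) hψ hcong
  calc 2 ^ ((q - 1).factorization 2)
      ≤ 2 ^ (c + ((q - 1).factorization 2 - c)) := Nat.pow_le_pow_right (by norm_num) (by omega)
    _ = 2 ^ c * 2 ^ ((q - 1).factorization 2 - c) := pow_add _ _ _
    _ ≤ 2 ^ c * ordProj[2] (S.xi fun n => (freyCurve (-(ℓ : ℤ)) ((ℓ - 1 : ℕ) : ℤ)).LFunction n) :=
        Nat.mul_le_mul_left _ hle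

/-- **Two-prime supply + depth law ⟹ `ProthDepthFamily`** (verbatim from the rev-5 skeleton). -/
theorem prothDepthFamily_of_forcedPairDepthLaw
    (hSup : ∃ A s₁ : ℕ, ∀ s : ℕ, s₁ ≤ s →
      ∃ q ℓ : ℕ, q.Prime ∧ ℓ.Prime ∧ 2 ^ s ∣ q - 1 ∧ 2 ^ s * q ∣ ℓ - 1 ∧ ℓ ≤ 2 ^ (A * s))
    (hF : ∃ c : ℕ, ∀ q ℓ : ℕ, q.Prime → ℓ.Prime → q ≠ 2 → 32 * q ∣ ℓ - 1 →
      ∀ N : ℕ, (freyCurve (-(ℓ : ℤ)) ((ℓ - 1 : ℕ) : ℤ)).conductorNorm ℤ = N →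
        2 ^ ((q - 1).factorization 2) ≤
          2 ^ c * ordProj[2] (brandtXi (N / ℓ) ℓ
            (fun n => (freyCurve (-(ℓ : ℤ)) ((ℓ - 1 : ℕ) : ℤ)).LFunction n))) :
    ProthDepthFamily := by
  obtain ⟨A, s₁, hAs⟩ := hSup
  obtain ⟨c, hc⟩ := hF
  refine ⟨c, A, fun s₀ => ?_⟩
  set s : ℕ := max s₀ (max s₁ 5) with hs
  have hs5 : 5 ≤ s := (le_max_right _ _).trans (le_max_right _ _)
  have hs₁ : s₁ ≤ s := (le_max_left _ _).trans (le_max_right _ _)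
  have h32s : (32 : ℕ) ∣ 2 ^ s := by
    rw [show (32 : ℕ) = 2 ^ 5 by norm_num]; exact Nat.pow_dvd_pow 2 hs5
  obtain ⟨q, ℓ, hq, hℓ, hsq, hsl, hℓA⟩ := hAs s hs₁
  have hq2 : q ≠ 2 := by
    intro h
    rw [h] at hsq
    have := Nat.le_of_dvd (by norm_num) (h32s.trans hsq)
    omega
  have h2sl : 2 ^ s ∣ ℓ - 1 := (Dvd.intro q rfl).trans hsl
  have h32q : 32 * q ∣ ℓ - 1 := (Nat.mul_dvd_mul_right h32s q).trans hsl
  refine ⟨s, ℓ, le_max_left _ _, hℓ, h2sl, hℓA, fun N hN => ?_⟩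
  have h := hc q ℓ hq hℓ hq2 h32q N hN
  have hqm1 : q - 1 ≠ 0 := by have := hq.two_le; omega
  have hsv : s ≤ (q - 1).factorization 2 :=
    (Nat.prime_two.pow_dvd_iff_le_factorization hqm1).mp hsq
  exact (Nat.pow_le_pow_right (by norm_num) hsv).trans h

/-- **Skeleton theorem of the rev-6 candidate** — `ProthDepthFamily` BY NAME from the four stubs:
supply ∘ (2a + (2b″ + 2c ⟹ modularity data on the family) ⟹ eigen-line on the family) ∘ occurrence. -/
theorem ProthDepthFamily_of : Summit.ABC.ABC.Theorems.EisensteinQuarantine.Negative.ProthDepthFamily :=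
  prothDepthFamily_of_forcedPairDepthLaw stub_twoPowerPrimeSupply
    (forcedPairDepthLaw_of_occurrence_forced
      (forcedEigenLine_of_rankOne_of_forcedModularity stub_brandtEigenLatticeRankOne
        (forcedModularity_of_caseAModularity_of_caseA stub_forcedCaseAModularity stub_forcedCaseA))
      stub_forcedPairOccurrence)

/-- **The line's end (unchanged): the crux is refuted.** -/
theorem EisensteinQuarantine_refuted_of : ¬ Summit.ABC.ABC.Theses.DefiniteXi.EisensteinQuarantine :=
  EisensteinQuarantine_false_of_ProthDepthFamily ProthDepthFamily_of

/-! ## Part 2 — helper chain for `stub_forcedCaseA` (stub-worker plan; A1a, A1b, A3 to prove) -/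

/-- **A1a (S, Diophantine core).**  `4 m³ (m−3)³ = R²` in integers forces `m ∈ {−1, 0, 3, 4}`:
`t := m(m−3) ≥ 0` (a cube equal to a square is `≥ 0`), `t³ = (R/2)²` gives `t ∣ R/2` (`Int.pow_dvd_pow_iff`)
and `t = k²`; then `(2m−3)² = 4k² + 9` has no solution with `|k| ≥ 3` (strictly between `(2|k|)²` and
`(2|k|+1)²`), and `|k| ≤ 2` leaves `(2m−3)² ∈ {9, 25}`. -/
theorem dioph_core (m R : ℤ) (h : 4 * m ^ 3 * (m - 3) ^ 3 = R ^ 2) :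
    m = -1 ∨ m = 0 ∨ m = 3 ∨ m = 4 := by
  sorry

/-- **A1b (M−, the Legendre `Ψ₃` rigidity).**  For an INTEGER `λ ∉ {0, 1}` the Legendre 3-division
polynomial `3X⁴ − 4(1+λ)X³ + 6λX² − λ²` has no rational root.  Route: `X' := 3X` is a root of the MONIC
integer quartic `X'⁴ − 4(1+λ)X'³ + 18λX'² − 27λ²`, hence an integer `m` (Mathlib
`exists_integer_of_is_root_of_monic`); the identity `729·Ψ₃(m/3) = 4m³(m−3)³ − (27λ − 9m² + 2m³)²` (`ring`)
and A1a give `m ∈ {−1,0,3,4}`, i.e. `27λ ∈ {−5 or 27, 0, 27, 32 or 0}` — impossible for `λ ∈ ℤ ∖ {0,1}`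
(`omega`).  Sharp: `λ = 32/27` (the case-B witness `5 + 27 = 32`) has the root `4/3`. -/
theorem psi3Legendre_ne_zero (la : ℤ) (h0 : la ≠ 0) (h1 : la ≠ 1) (X : ℚ) :
    3 * X ^ 4 - 4 * (1 + (la : ℚ)) * X ^ 3 + 6 * (la : ℚ) * X ^ 2 - (la : ℚ) ^ 2 ≠ 0 := by
  sorry

/-- **A2 (proved): `Ψ₃` of the forced curve is the Legendre `Ψ₃` at `X = x + ℓ`, `λ = ℓ`.** -/
theorem eval_psi3_forced_eq (ℓ : ℕ) (hℓ : 1 ≤ ℓ) (x : ℚ) :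
    (freyCurve (-(ℓ : ℤ)) ((ℓ - 1 : ℕ) : ℤ)).Ψ₃.eval x =
      3 * (x + ℓ) ^ 4 - 4 * (1 + (ℓ : ℚ)) * (x + ℓ) ^ 3 + 6 * (ℓ : ℚ) * (x + ℓ) ^ 2 - (ℓ : ℚ) ^ 2 := by
  simp only [freyCurve, Ψ₃, b₂, b₄, b₆, b₈, eval_add, eval_mul, eval_pow, eval_C, eval_X,
    eval_ofNat, Int.cast_neg, Int.cast_natCast, Nat.cast_sub hℓ, Nat.cast_one, Int.cast_sub,
    Int.cast_one]
  ring

/-- **A2′ (proved from A1b): `Ψ₃(E_ℓ)` has no rational root for `ℓ ≥ 2`.** -/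
theorem eval_psi3_forced_ne_zero (ℓ : ℕ) (hℓ : 2 ≤ ℓ) (x : ℚ) :
    (freyCurve (-(ℓ : ℤ)) ((ℓ - 1 : ℕ) : ℤ)).Ψ₃.eval x ≠ 0 := by
  rw [eval_psi3_forced_eq ℓ (by omega) x]
  have h := psi3Legendre_ne_zero (ℓ : ℤ) (by exact_mod_cast (show ℓ ≠ 0 by omega))
    (by exact_mod_cast (show ℓ ≠ 1 by omega)) (x + ℓ)
  simpa using h

/-- **A3 (M, general descent lemma).**  If `Ψ₃` has no rational root then `E[3]` has no `Γ_ℚ`-stable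
line, i.e. `HasIrreducibleModPGaloisRep 3`: a stable `H ∉ {⊥, ⊤}` has `Nat.card H = 3`
(`not_hasIrreducibleModPGaloisRep_iff_exists_natCard_eq`), so `H = ℤ·P`, `P ≠ 0`
(`exists_eq_zmultiples_of_natCard_eq`) and `σ • P = (r σ).val • P ∈ {P, 2•P = −P}` (`exists_isogenyCharacter`);
with `P = some x y` the action is coordinatewise (`σ • P = Point.map σ P`, `Affine.Point.map_some`,
`Affine.Point.neg_some`), so `σ • x = x` for all `σ`, `x = algebraMap ℚ _ x₀`
(`MordellDescent.exists_algebraMap_eq_of_forall_galAut` / `InfiniteGalois.mem_range_algebraMap_iff_fixed`),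
and `Ψ₃(x) = 0` over `ℚ̄` (`eval_divisionPolynomial_three_eq_zero_of_eq_some`, `map_Ψ₃`, `eval_map`)
descends to `W.Ψ₃.eval x₀ = 0`. -/
theorem hasIrreducibleModPGaloisRep_three_of_forall_eval_psi3_ne_zero (W : WeierstrassCurve ℚ)
    [W.IsElliptic] (h : ∀ x : ℚ, W.Ψ₃.eval x ≠ 0) : W.HasIrreducibleModPGaloisRep 3 := by
  sorry

/-- **Assembly of stub 2c from A2′ + A3 (proved): case A on the forced family** — contrapositive of the
landed `exists_stableLine_three_freyCurve_of_caseB` (`A = −ℓ ≡ −1 (mod 4)`, `2 ∣ B = ℓ − 1`). -/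
theorem forcedCaseA_of_helpers
    (hA3 : ∀ (W : WeierstrassCurve ℚ) [W.IsElliptic],
      (∀ x : ℚ, W.Ψ₃.eval x ≠ 0) → W.HasIrreducibleModPGaloisRep 3)
    (hA2 : ∀ ℓ : ℕ, 2 ≤ ℓ → ∀ x : ℚ, (freyCurve (-(ℓ : ℤ)) ((ℓ - 1 : ℕ) : ℤ)).Ψ₃.eval x ≠ 0) :
    ∀ ℓ : ℕ, ℓ.Prime → 32 ∣ ℓ - 1 →
      ∃ ρ : ModPGaloisRep ℚ (ZMod 3) 2,
        (freyCurve (-(ℓ : ℤ)) ((ℓ - 1 : ℕ) : ℤ)).IsTorsionGaloisRep 3 ρ ∧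
          ρ.IsAbsIrreducibleOverSqrt (-3) := by
  intro ℓ hℓ h32
  obtain ⟨hab, -, h0⟩ := forced_domain hℓ
  obtain ⟨ha4, hb32⟩ := forced_serre hℓ h32
  haveI := isElliptic_freyCurve h0
  by_contra hcon
  push Not at hcon
  have h2 : (2 : ℤ) ∣ ((ℓ - 1 : ℕ) : ℤ) := (show (2 : ℤ) ∣ 32 by norm_num).trans hb32
  obtain ⟨H, hstab, hbot, htop, -⟩ :=
    Summit.ABC.ABC.Theorems.exists_stableLine_three_freyCurve_of_caseB hab h0 ha4 h2 hcon
  rcases hA3 _ (hA2 ℓ hℓ.two_le) H hstab with h | h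
  · exact hbot h
  · exact htop h

/-- The stub 2c statement from the three helpers (this is what the `--supports` file ends with, under the
registered name `stub_forcedCaseA`). -/
theorem forcedCaseA :
    ∀ ℓ : ℕ, ℓ.Prime → 32 ∣ ℓ - 1 →
      ∃ ρ : ModPGaloisRep ℚ (ZMod 3) 2,
        (freyCurve (-(ℓ : ℤ)) ((ℓ - 1 : ℕ) : ℤ)).IsTorsionGaloisRep 3 ρ ∧
          ρ.IsAbsIrreducibleOverSqrt (-3) :=
  forcedCaseA_of_helpers (fun W _ h ↦ hasIrreducibleModPGaloisRep_three_of_forall_eval_psi3_ne_zero W h)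
    eval_psi3_forced_ne_zero

/-! ## Sanity (sorry-free): the two `Ψ₃` identities behind A1b -/

example (la X : ℚ) :
    3 * X ^ 4 - 4 * (1 + la) * X ^ 3 + 6 * la * X ^ 2 - la ^ 2
      = 4 * X ^ 3 * (X - 1) ^ 3 - (la - 3 * X ^ 2 + 2 * X ^ 3) ^ 2 := by ring

/-- `729 · Ψ₃(m/3) = 4m³(m−3)³ − (27λ − 9m² + 2m³)²` and `27 · Ψ₃(X) = Q(3X)` with `Q` monic. -/
example (la m : ℚ) :
    729 * (3 * (m / 3) ^ 4 - 4 * (1 + la) * (m / 3) ^ 3 + 6 * la * (m / 3) ^ 2 - la ^ 2)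
      = 4 * m ^ 3 * (m - 3) ^ 3 - (27 * la - 9 * m ^ 2 + 2 * m ^ 3) ^ 2 := by ring

example (la X : ℚ) :
    27 * (3 * X ^ 4 - 4 * (1 + la) * X ^ 3 + 6 * la * X ^ 2 - la ^ 2)
      = (3 * X) ^ 4 - 4 * (1 + la) * (3 * X) ^ 3 + 18 * la * (3 * X) ^ 2 - 27 * la ^ 2 := by ring

/-- the four exceptional `m` and the `λ` they force -/
example (la : ℚ) (h : 4 * (4 : ℚ) ^ 3 * (4 - 3) ^ 3 - (27 * la - 9 * 4 ^ 2 + 2 * 4 ^ 3) ^ 2 = 0) :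
    la = 32 / 27 ∨ la = 0 := by
  have : (27 * la - 32) * (27 * la) = 0 := by nlinarith [h]
  rcases mul_eq_zero.mp this with h | h
  · left; linarith
  · right; linarith

example (la : ℚ) (h : 4 * (-1 : ℚ) ^ 3 * (-1 - 3) ^ 3 - (27 * la - 9 * (-1) ^ 2 + 2 * (-1) ^ 3) ^ 2 = 0) :
    la = 1 ∨ la = -5 / 27 := by
  have : (27 * la - 27) * (27 * la + 5) = 0 := by nlinarith [h]
  rcases mul_eq_zero.mp this with h | h
  · left; linarith
  · right; linarith

end Summit.ABC.ABC.Cruxes.EisensteinQuarantine.ForcedPairDlog.StubPlan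

end
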